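/-
Copyright (c) 2026 the pub-hodgecm-mathlib formalisation cell (harness21).  Prover seat hodgecm-mathlib-K2E4-p11 (g3), Track B ∕ K2-LIT, h413 =
`stmt-HodgeConjecture-24833`, line `K2_E1_TraceFormulaBeta`, campaign «EIS-RANK-ONE», rung R6d₃, deal (D2-c) PART I of K2E1-plan (g3) 2026-09-04T05:52:56Z (the `N = 3`
twin of K2E1-p09 (g5)'s (D1-c) PART I `K2E1FlatSectionLineRestrictionU2`), FILE A: the big-cell function on the HEISENBERG group — line algebra, tube lemma, majorants,
and the centre-line binders `hΦc`, `hΦi`, `hloc` of ★ p857586.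
-/
import Summits.HodgeConjecture.HodgeConjecture.Theorems.K2E1EisensteinMinusConstantTermPoissonU3   -- ★ p857586 (a) at `N = 3`: letters, `ratHeis_mem_unipotentU`, `conj_algebraMap_mul_delta`
import Summits.HodgeConjecture.HodgeConjecture.Theorems.K2E1BruhatCosetsU                         -- ★ `exists_equiv_option_borelQuotient_three` (`n ↦ [w₀ n]` injective)
import Literature.NumberTheory.Automorphic.UnramifiedHeckeScalarsProofs                           -- ★ `FiniteAdeleRing.exists_forall_valued_le_idealRadius_imp_mem` (ideal boxes are cofinal)
import Literature.NumberTheory.Automorphic.StrongApproximationGL2                                 -- ★ `levelIdeal`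
import Literature.NumberTheory.Automorphic.UnitaryGroupHeisenbergKAverageSchwartzBruhat           -- ★ `heisChart_zero`, `heisChart_add_eq_mul`, the `E`-level tube lemma `exists_levelIdeal_forall_conj_heisChart_mem`
import HarnessLib

/-!
# h413 ∕ Track B «K2-LIT», «EIS-RANK-ONE» R6d₃ (D2-c) PART I, FILE A — `K2E1FlatSectionLineRestrictionU3`:
# the big-cell function `Φ_g(X, t) = f(ι(w₀)·u(X, θ t)·g)` on the Heisenberg group of `U(J₃)`: line algebra, level periodicity, majorants, and the
# centre-line Poisson binders `hΦc`, `hΦi`, `hloc` of ★ p857586 — for EVERY `X ∈ 𝔸_E`, from the Eisenstein majorant alone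

Cell `pub/hodgecm-mathlib`, crux H413 = `stmt-HodgeConjecture-24833`, route `HCCMUnconditional`; dealer K2E1-plan (g3), deal (D2-c) 2026-09-04T05:52:56Z, ruling «R6d-FIBREWISE»
05:44:38Z (4); REPORT-FIRST 05:56:16Z.  THEOREMS ONLY (no `def`, no `instance`, no `notation`, no named-fact hypothesis, no `sorry`); lane `--kind proof --supports
stmt-HodgeConjecture-24833 --as helper` (count-neutral).

THE OBJECT (letters of ★ p857586 `K2E1EisensteinMinusConstantTermPoissonU3` verbatim).  For `f : U(J₃)(𝔸_F) → ℂ` and `g ∈ U(J₃)(𝔸_F)`: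
`Φ_g(X, t) := f(ι(w₀) · u(X, θ t) · g)`, `X ∈ 𝔸_E`, `t ∈ 𝔸_F`, with `u = heisChart hc : 𝔸_E × 𝔸_E⁻ ≃ₜ N(𝔸_F)` (★) and `θ = traceZeroLine F E c hcδ hδ : 𝔸_F ≃ₜ+ 𝔸_E⁻` (★);
spelled out, no definition.  Inputs: `hfB` (left `B(F)`-invariance) and — the ONE analytic input — the locally uniform summable EISENSTEIN MAJORANT `hmaj` of the terms
`q ↦ f(ι(q̃)·y)` on `B(F)∖G(F)` (★ R2 ∕ R4a shape, e.g. ★ `exists_locallyUniform_majorant_flatSectionU_cm_three`); `hf : Continuous f` for `hΦc`.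
STRUCTURAL DIFFERENCE FROM `N = 2` (★ K2E1-p09's (D1-c)): the centre-line fibres `{X} × 𝔸_F` are null sets of `N(𝔸) ≅ 𝔸_E × 𝔸_E⁻`, so Godement's `hfin` (an `L¹(N(𝔸))`
statement) cannot give the per-fibre integrability `hΦi` of ★ (a); here (i) is derived for EVERY `X` from `hmaj` by the lattice argument of §0 — no local integral, no `hfin`.
* §0 (any number field `K`) `integrable_of_lattice_majorant` — a measurable `Ψ` on `𝔸_K` with `‖Ψ(ξ + x)‖ ≤ u(ξ)` for `x ∈ D_K`, `ξ ∈ K`, `Σ u < ∞`, is integrable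
  (`∫⁻‖Ψ‖ = Σ_ξ ∫⁻_{D_K} ‖Ψ(ξ + ·)‖ ≤ μ(D_K)·Σ u`, ★ `isAddFundamentalDomain_adeleFundamentalDomain`, `D_K` relatively compact ★).
* §1 HEISENBERG LINE ALGEBRA in the chart (★ `coordX_mul_heisChart`, ★ `coe_coordY_mul_heisChart`): the centre is central (`heisChart_zero_mul`, `heisChart_mul_zero`; `u(0,0) = 1` and the
  `X`-translation law are ★ `heisChart_zero`, ★ `heisChart_add_eq_mul`), the rational big-cell elements
  `ι(n(x₀,t)) = u((x₀)_𝔸, θ t_𝔸)`, `n(x₀,t) ∈ N(F)` (`exists_unipotentU_toAdelic_eq_heisChart`) and the injectivity of `(x₀, t) ↦ [w₀ · n(x₀, t)] ∈ B(F)∖G(F)`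
  (`injective_borelQuotient_weylLongU_mul`, ★ `exists_equiv_option_borelQuotient_three`).
* §2 (ii) THE TUBE LEMMA ON THE HEISENBERG GROUP `exists_levelIdeal_forall_conj_heisChart_mem_three` — for compact `K` and open `U ∋ 1` ONE pair of levels `𝔫 ⊆ 𝓞_F`, `𝔪 ⊆ 𝓞_E`
  with `k⁻¹ · u((0,L), θ(0,l)) · k ∈ U` for all `k ∈ K`, `l ∈ 𝔫𝒪̂_F`, `L ∈ 𝔪𝒪̂_E` (Mathlib `generalized_tube_lemma`, ★ ideal boxes cofinal); the CENTRE periodicity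
  `Φ_k(X, t + (0,l)) = Φ_k(X, t)` for right-`U`-invariant `f` (`apply_heisChart_add_inr_eq`); the `E`-layer periodicity is in FILE B (it needs the `dt`-integral).
* §3 MAJORANTS: `exists_summable_majorant_on_isCompact'` (finite subcover, `N`-generic, non-negative output); THE MASTER MAJORANT **`exists_summable_majorant_weylLongU_ratHeis_three`**
  — for compact `C_X ⊆ 𝔸_E`, `C ⊆ 𝔸_F` ONE summable `U : E × F → ℝ` with `‖f(ι(w₀)·u((x₀)_𝔸, θ τ_𝔸)·u(X, θ t)·g)‖ ≤ U(x₀, τ)` for `X ∈ C_X`, `t ∈ C` (the term at the coset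
  `[w₀ u(x₀, τδ)]`, representative independence ★ `eisensteinSeriesU_term_eq`, `Summable.comp_injective`); the centre-line corollaries **`exists_summable_majorant_centre_translate_three`**
  (`hloc`, every `X`: `‖Φ_g(X, x + ξ)‖ ≤ u(ξ)`), **`continuous_weylLongU_mul_heisChart_mul`** (`hΦc`), **`integrable_centreLine_three`** (`hΦi`, every `X`).
NOT here: the `E`-layer `Φ^Z_g` (FILE B `K2E1FlatSectionCentreAverageU3`: `hlocZ`, `hΦZc`, `hΦZi`, `E`-periodicity) and (iii″) (PART II, K2E4-p10 (g3)).
HONEST LABEL.  Count-neutral helper; proves no printed statement; HC_CM is proved only modulo the 7 printed citations (2 remaining named inputs: hLiu418 =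
`stmt-HodgeConjecture-24832`, h413 = `stmt-HodgeConjecture-24833`) until rung 0 closes.

## References
* [MoeglinWaldspurger1995] C. Mœglin, J.-L. Waldspurger, *Spectral decomposition and Eisenstein series* (1995), I.2.6, II.1.5, II.1.7.
* [Garrett2018] P. Garrett, *Modern Analysis of Automorphic Forms by Example* 1 (2018), §2.8–§2.9.
* [Rogawski1990] J. D. Rogawski, *Automorphic Representations of Unitary Groups in Three Variables* (1990), §1.10, §2.1, §7.3 (pp. 97–98).
* [WeilBNT1967] A. Weil, *Basic Number Theory* (1967), Ch. IV §2, Ch. VII §2.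
* [CasselsFrohlichANT1967] J. W. S. Cassels, A. Fröhlich (eds.), *Algebraic Number Theory* (1967), Ch. XV (Tate) Lemma 4.2.4.
-/

set_option autoImplicit false
set_option linter.dupNamespace false  -- the mandated namespace repeats the summit's segment (`HodgeConjecture.HodgeConjecture`)

noncomputable section

open MeasureTheory Measure Filter Topology NumberField IsDedekindDomain MulAction Set
open Literature.NumberTheory.Automorphic Literature.NumberTheory.Automorphic.UnitaryGroup
open Summit.HodgeConjecture.HodgeConjecture.Cruxes.H413.K2E1BorelEisensteinU
open Summit.HodgeConjecture.HodgeConjecture.Cruxes.H413.K2E1EisensteinSeriesLeftRight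
open Summit.HodgeConjecture.HodgeConjecture.Cruxes.H413.K2E1EisensteinMinusConstantTermPoissonU3
open Summit.HodgeConjecture.HodgeConjecture.Cruxes.H413.K2E1BruhatCosetsU
open scoped ENNReal NNReal Pointwise

namespace Summit.HodgeConjecture.HodgeConjecture.Cruxes.H413.K2E1FlatSectionLineRestrictionU3

/-! ## §0 A lattice-translate majorant on the fundamental domain makes a function integrable on `𝔸_K` -/

section Lattice

/-- **LATTICE MAJORANT ⟹ INTEGRABLE** (any number field `K`, additive Haar `μ` on `𝔸_K`): if `Ψ` is a.e.-strongly measurable and `‖Ψ(ξ + x)‖ ≤ u(ξ)` for all `x` in Tate's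
fundamental domain `D_K` and all `ξ ∈ K`, with `0 ≤ u`, `Σ u < ∞`, then `Ψ ∈ L¹(𝔸_K)`: `∫⁻ ‖Ψ‖ = Σ_ξ ∫⁻_{D_K} ‖Ψ(ξ + ·)‖ ≤ μ(D_K) · Σ_ξ u(ξ) < ∞` (★
`isAddFundamentalDomain_adeleFundamentalDomain`; `D_K` is relatively compact ★ `isCompact_closure_adeleFundamentalDomain`). [cite: CasselsFrohlichANT1967, Ch. XV Lemma 4.2.4] [cite: WeilBNT1967, Ch. IV §2] -/
theorem integrable_of_lattice_majorant (K : Type) [Field K] [NumberField K] [MeasurableSpace (AdeleRing (𝓞 K) K)] [BorelSpace (AdeleRing (𝓞 K) K)]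
    (μ : Measure (AdeleRing (𝓞 K) K)) [μ.IsAddHaarMeasure] {V : Type*} [NormedAddCommGroup V] {Ψ : AdeleRing (𝓞 K) K → V}
    (hΨm : AEStronglyMeasurable Ψ μ) {u : K → ℝ} (hu0 : ∀ ξ, 0 ≤ u ξ) (hu : Summable u)
    (hle : ∀ x ∈ adeleFundamentalDomain K, ∀ ξ : K, ‖Ψ (algebraMap K (AdeleRing (𝓞 K) K) ξ + x)‖ ≤ u ξ) : Integrable Ψ μ := by
  classical
  refine ⟨hΨm, ?_⟩
  have h𝓓 := isAddFundamentalDomain_adeleFundamentalDomain K μ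
  have hDtop : μ (adeleFundamentalDomain K) < ⊤ :=
    (measure_mono subset_closure).trans_lt (isCompact_closure_adeleFundamentalDomain K).measure_lt_top
  -- `∫⁻ ‖Ψ‖ = Σ_{γ ∈ K} ∫⁻_{D} ‖Ψ(γ + x)‖ ≤ Σ_γ u(γ)·μ(D)`
  have hsum : ∫⁻ x, ‖Ψ x‖ₑ ∂μ ≤ ∑' ξ : K, ENNReal.ofReal (u ξ) * μ (adeleFundamentalDomain K) := by
    rw [h𝓓.lintegral_eq_tsum'' fun x => ‖Ψ x‖ₑ, ← (principalSubgroupEquiv K).tsum_eq]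
    refine ENNReal.tsum_le_tsum fun ξ => ?_
    calc ∫⁻ x in adeleFundamentalDomain K, ‖Ψ ((principalSubgroupEquiv K ξ) +ᵥ x)‖ₑ ∂μ
        ≤ ∫⁻ _ in adeleFundamentalDomain K, ENNReal.ofReal (u ξ) ∂μ := by
          refine setLIntegral_mono measurable_const fun x hx => ?_
          rw [← ofReal_norm]
          exact ENNReal.ofReal_le_ofReal (hle x hx ξ)
      _ = ENNReal.ofReal (u ξ) * μ (adeleFundamentalDomain K) := setLIntegral_const _ _
  refine lt_of_le_of_lt hsum ?_
  rw [ENNReal.tsum_mul_right, ← ENNReal.ofReal_tsum_of_nonneg hu0 hu]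
  exact ENNReal.mul_lt_top ENNReal.ofReal_lt_top hDtop

end Lattice

section Heisenberg

variable {F E : Type} [Field F] [NumberField F] [Field E] [NumberField E] [Algebra F E] [Algebra.IsQuadraticExtension F E] {c : E ≃ₐ[F] E}
  {δ : E}

/-! ## §1 Heisenberg line algebra in the chart `u = heisChart` -/

omit [Algebra.IsQuadraticExtension F E] in
/-- **The centre is central, I**: `u(0, s′) · u(X, s) = u(X, s + s′)`. [cite: Rogawski1990, §1.10] -/
theorem heisChart_zero_mul (hc : c * c = 1) (X : AdeleRing (𝓞 E) E) (s s' : traceZeroAdele F E c) :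
    heisChart hc (0, s') * heisChart hc (X, s) = heisChart hc (X, s + s') := by
  rw [← heisChart_coord hc (heisChart hc (0, s') * heisChart hc (X, s))]
  congr 1
  refine Prod.ext ?_ (Subtype.ext ?_)
  · rw [coordX_mul_heisChart, coordX_heisChart, zero_add]
  · rw [coe_coordY_mul_heisChart, coordY_heisChart, coordX_heisChart]
    simp only [map_zero, mul_zero, zero_mul, sub_self, add_zero, AddMemClass.coe_add]

omit [Algebra.IsQuadraticExtension F E] in
/-- **The centre is central, II**: `u(X, s) · u(0, s′) = u(X, s + s′)`. [cite: Rogawski1990, §1.10] -/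
theorem heisChart_mul_zero (hc : c * c = 1) (X : AdeleRing (𝓞 E) E) (s s' : traceZeroAdele F E c) :
    heisChart hc (X, s) * heisChart hc (0, s') = heisChart hc (X, s + s') := by
  rw [← heisChart_coord hc (heisChart hc (X, s) * heisChart hc (0, s'))]
  congr 1
  refine Prod.ext ?_ (Subtype.ext ?_)
  · rw [coordX_mul_heisChart, coordX_heisChart, add_zero]
  · rw [coe_coordY_mul_heisChart, coordY_heisChart, coordX_heisChart]
    simp only [map_zero, mul_zero, zero_mul, sub_self, add_zero, AddMemClass.coe_add, add_comm]

/-- **The rational big-cell elements in the chart**: for `x₀ ∈ E`, `t ∈ F` there is `n ∈ N(F) = unipotentU` with `ι(n) = u((x₀)_𝔸, θ(t_𝔸))` and matrix `u(x₀, z₀)`, `z₀ = ratZ x₀ (tδ)`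
(★ `ratHeis`, ★ `toAdelic_ratHeis`, ★ `coe_traceZeroLine_algebraMap`; packaged as an existence so that downstream terms live in `↥(unipotentU)`). [cite: Rogawski1990, §1.10] -/
theorem exists_unipotentU_toAdelic_eq_heisChart (hc : c * c = 1) (hcδ : c δ = -δ) (hδ : δ ≠ 0) (x₀ : E) (t : F) :
    ∃ n : ↥(unipotentU (c : E →+* E) ((StdForm.antidiagonal 3).over E)),
      (quasiSplit F E c 3).toAdelic (n : ↥(unitaryGroupOfForm (c : E →+* E) ((StdForm.antidiagonal 3).over E))) =
          ((heisChart hc (algebraMap E (AdeleRing (𝓞 E) E) x₀, traceZeroLine F E c hcδ hδ (algebraMap F (AdeleRing (𝓞 F) F) t)) : ↥(adelicUnipotent F E c 3)) :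
            (quasiSplit F E c 3).Adelic) ∧
        (((n : ↥(unitaryGroupOfForm (c : E →+* E) ((StdForm.antidiagonal 3).over E))) : GL (Fin 3) E) : Matrix (Fin 3) (Fin 3) E) =
          ratHeisMatrix (c := c) x₀ (algebraMap F E t * δ) := by
  refine ⟨⟨⟨(ratHeis hc x₀ (conj_algebraMap_mul_delta hcδ t)).1, (ratHeis hc x₀ (conj_algebraMap_mul_delta hcδ t)).2⟩, ratHeis_mem_unipotentU hc x₀ _⟩, ?_, rfl⟩
  show ((quasiSplit F E c 3).toAdelic (ratHeis hc x₀ (conj_algebraMap_mul_delta hcδ t)) : (quasiSplit F E c 3).Adelic) = _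
  rw [toAdelic_ratHeis]
  congr 3
  exact Subtype.ext (coe_traceZeroLine_algebraMap E c hcδ hδ t).symm

omit [NumberField F] [NumberField E] [Algebra.IsQuadraticExtension F E] in
/-- **`(x₀, t) ↦ [w₀ · u(x₀, tδ)] ∈ B(F)∖U(J₃)(F)` IS INJECTIVE** for any choice `n(x₀, t) ∈ N(F)` of matrices `u(x₀, ratZ x₀ (tδ))` (★ `exists_equiv_option_borelQuotient_three`: `n ↦ [w₀ n]` is
injective on `N(F)`; the entries `(0,1)`, `(0,2)` recover `x₀` and `tδ`). [cite: Rogawski1990, §1.10 p. 9] -/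
theorem injective_borelQuotient_weylLongU_mul (hδ : δ ≠ 0) {nU : E × F → ↥(unipotentU (c : E →+* E) ((StdForm.antidiagonal 3).over E))}
    (hmat : ∀ p, (((nU p : ↥(unitaryGroupOfForm (c : E →+* E) ((StdForm.antidiagonal 3).over E))) : GL (Fin 3) E) : Matrix (Fin 3) (Fin 3) E) =
      ratHeisMatrix (c := c) p.1 (algebraMap F E p.2 * δ)) :
    Function.Injective fun p : E × F =>
      Quotient.mk (orbitRel ↥(borelU (c : E →+* E) ((StdForm.antidiagonal 3).over E)) ↥(unitaryGroupOfForm (c : E →+* E) ((StdForm.antidiagonal 3).over E)))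
        (weylLongU (c : E →+* E) (rfl : ((StdForm.antidiagonal 3).over E) = ((StdForm.antidiagonal 3).over E)) *
          (nU p : ↥(unitaryGroupOfForm (c : E →+* E) ((StdForm.antidiagonal 3).over E)))) := by
  classical
  have hinj : Function.Injective nU := by
    intro p q h
    have hM := congrArg (fun n : ↥(unipotentU (c : E →+* E) ((StdForm.antidiagonal 3).over E)) =>
      (((n : ↥(unitaryGroupOfForm (c : E →+* E) ((StdForm.antidiagonal 3).over E))) : GL (Fin 3) E) : Matrix (Fin 3) (Fin 3) E)) h
    simp only [hmat] at hM
    have h01 := congrFun (congrFun hM 0) 1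
    have h02 := congrFun (congrFun hM 0) 2
    simp only [ratHeisMatrix, Matrix.of_apply, Matrix.cons_val', Matrix.cons_val_zero, Matrix.cons_val_one, Matrix.cons_val_two, Matrix.empty_val',
      Matrix.cons_val_fin_one, Matrix.head_cons, Matrix.tail_cons] at h01 h02
    have h1 : p.1 = q.1 := h01
    have h2 : p.2 = q.2 := by
      rw [ratZ, ratZ, h1] at h02
      have h' : algebraMap F E p.2 * δ = algebraMap F E q.2 * δ := by linear_combination h02
      exact (algebraMap F E).injective (mul_right_cancel₀ hδ h')
    exact Prod.ext h1 h2
  obtain ⟨e, -, he⟩ := exists_equiv_option_borelQuotient_three (c : E →+* E) (rfl : ((StdForm.antidiagonal 3).over E) = ((StdForm.antidiagonal 3).over E))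
  intro p q h
  have h' : e (some (nU p)) = e (some (nU q)) := by rw [he, he]; exact h
  exact hinj (Option.some_injective _ (e.injective h'))

/-! ## §2 (ii) The tube lemma on the Heisenberg group and the centre periodicity -/

/-- **THE TUBE LEMMA ON `N(𝔸_F)`** (`N = 3`): for a compact `K ⊆ G(𝔸_F)` and an open `U ∋ 1` there are levels `𝔫 ≠ 0` of `𝓞_F` and `𝔪 ≠ 0` of `𝓞_E` with
`k⁻¹ · u((0, L), θ(0, l)) · k ∈ U` for every `k ∈ K`, `l ∈ 𝔫𝒪̂_F`, `L ∈ 𝔪𝒪̂_E` (Mathlib `generalized_tube_lemma` on `K × {(0,0)}`; ideal boxes are cofinal among the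
neighbourhoods of `0` in `𝔸^∞`, ★ `FiniteAdeleRing.exists_forall_valued_le_idealRadius_imp_mem`, in `E` and in `F`). `N = 3` twin of ★
`exists_levelIdeal_forall_conj_line_traceZeroLine_mem_two`. [cite: WeilBNT1967, Ch. VII §2] [cite: Rogawski1990, §7.3 (pp. 97–98)] -/
theorem exists_levelIdeal_forall_conj_heisChart_mem_three (hc : c * c = 1) (hcδ : c δ = -δ) (hδ : δ ≠ 0)
    {K : Set (quasiSplit F E c 3).Adelic} (hK : IsCompact K) {U : Set (quasiSplit F E c 3).Adelic} (hUo : IsOpen U) (hU1 : (1 : (quasiSplit F E c 3).Adelic) ∈ U) :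
    ∃ 𝔫 : Ideal (𝓞 F), 𝔫 ≠ 0 ∧ ∃ 𝔪 : Ideal (𝓞 E), 𝔪 ≠ 0 ∧ ∀ k ∈ K, ∀ l ∈ levelIdeal F 𝔫, ∀ L ∈ levelIdeal E 𝔪,
      k⁻¹ * ((heisChart hc ((((0 : InfiniteAdeleRing E), L) : AdeleRing (𝓞 E) E),
        traceZeroLine F E c hcδ hδ (((0 : InfiniteAdeleRing F), l) : AdeleRing (𝓞 F) F)) : ↥(adelicUnipotent F E c 3)) : (quasiSplit F E c 3).Adelic) * k ∈ U := by
  set Θ : (quasiSplit F E c 3).Adelic × (FiniteAdeleRing (𝓞 E) E × FiniteAdeleRing (𝓞 F) F) → (quasiSplit F E c 3).Adelic := fun p =>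
    p.1⁻¹ * ((heisChart hc ((((0 : InfiniteAdeleRing E), p.2.1) : AdeleRing (𝓞 E) E),
      traceZeroLine F E c hcδ hδ (((0 : InfiniteAdeleRing F), p.2.2) : AdeleRing (𝓞 F) F)) : ↥(adelicUnipotent F E c 3)) : (quasiSplit F E c 3).Adelic) * p.1 with hΘ
  have hEc : Continuous fun L : FiniteAdeleRing (𝓞 E) E => ((((0 : InfiniteAdeleRing E), L) : AdeleRing (𝓞 E) E)) := continuous_const.prodMk continuous_id
  have hFc : Continuous fun l : FiniteAdeleRing (𝓞 F) F => ((((0 : InfiniteAdeleRing F), l) : AdeleRing (𝓞 F) F)) := continuous_const.prodMk continuous_id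
  have hΘc : Continuous Θ := by
    refine (continuous_fst.inv.mul ?_).mul continuous_fst
    refine continuous_subtype_val.comp ((heisChart hc).continuous.comp ?_)
    exact (hEc.comp (continuous_fst.comp continuous_snd)).prodMk
      ((traceZeroLine F E c hcδ hδ).continuous.comp (hFc.comp (continuous_snd.comp continuous_snd)))
  have hsub : K ×ˢ ({(0, 0)} : Set (FiniteAdeleRing (𝓞 E) E × FiniteAdeleRing (𝓞 F) F)) ⊆ Θ ⁻¹' U := by
    rintro ⟨k, p⟩ ⟨-, hp⟩
    rw [mem_singleton_iff] at hp
    subst hp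
    have hθ0 : traceZeroLine F E c hcδ hδ ((((0 : InfiniteAdeleRing F), (0 : FiniteAdeleRing (𝓞 F) F)) : AdeleRing (𝓞 F) F)) = 0 := map_zero _
    have hE0 : heisChart hc ((((0 : InfiniteAdeleRing E), (0 : FiniteAdeleRing (𝓞 E) E)) : AdeleRing (𝓞 E) E), (0 : traceZeroAdele F E c)) = 1 :=
      heisChart_zero hc
    have h1 : Θ (k, (0, 0)) = 1 := by
      show k⁻¹ * ((heisChart hc ((((0 : InfiniteAdeleRing E), (0 : FiniteAdeleRing (𝓞 E) E)) : AdeleRing (𝓞 E) E),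
        traceZeroLine F E c hcδ hδ (((0 : InfiniteAdeleRing F), (0 : FiniteAdeleRing (𝓞 F) F)) : AdeleRing (𝓞 F) F)) : ↥(adelicUnipotent F E c 3)) :
          (quasiSplit F E c 3).Adelic) * k = 1
      rw [hθ0, hE0, Subgroup.coe_one, mul_one, inv_mul_cancel]
    show Θ (k, (0, 0)) ∈ U
    rw [h1]
    exact hU1
  obtain ⟨u', v, -, hvo, hKu', h0v, huv⟩ := generalized_tube_lemma hK isCompact_singleton (hUo.preimage hΘc) hsub
  have hv : v ∈ 𝓝 ((0 : FiniteAdeleRing (𝓞 E) E), (0 : FiniteAdeleRing (𝓞 F) F)) := hvo.mem_nhds (h0v (mem_singleton _))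
  obtain ⟨vE, hvE, vF, hvF, hvv⟩ := mem_nhds_prod_iff.1 hv
  obtain ⟨𝔪, h𝔪, h𝔪v⟩ := FiniteAdeleRing.exists_forall_valued_le_idealRadius_imp_mem (K := E) hvE
  obtain ⟨𝔫, h𝔫, h𝔫v⟩ := FiniteAdeleRing.exists_forall_valued_le_idealRadius_imp_mem (K := F) hvF
  refine ⟨𝔫, h𝔫, 𝔪, h𝔪, fun k hk l hl L hL => ?_⟩
  have hmem : (k, (L, l)) ∈ Θ ⁻¹' U := huv ⟨hKu' hk, hvv ⟨h𝔪v L fun w => hL w, h𝔫v l fun w => hl w⟩⟩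
  exact hmem

/-- **CENTRE PERIODICITY**: if `f` is right-`U`-invariant and `k⁻¹ · u(0, θ l′) · k ∈ U`, then `Φ_k(X, t + l′) = Φ_k(X, t)` for every `X`, `t` (§1: the centre is
central, so translating `t` is right multiplication by a `k`-conjugate of a centre element). [cite: Rogawski1990, §1.10] [cite: WeilBNT1967, Ch. VII §2] -/
theorem apply_weylLongU_mul_heisChart_add_eq (hc : c * c = 1) (hcδ : c δ = -δ) (hδ : δ ≠ 0)
    {α : Type*} {f : (quasiSplit F E c 3).Adelic → α} {U : Subgroup (quasiSplit F E c 3).Adelic}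
    (hfU : ∀ v ∈ U, ∀ y : (quasiSplit F E c 3).Adelic, f (y * v) = f y) {k : (quasiSplit F E c 3).Adelic} {l' : AdeleRing (𝓞 F) F}
    (hk : k⁻¹ * ((heisChart hc ((0 : AdeleRing (𝓞 E) E), traceZeroLine F E c hcδ hδ l') : ↥(adelicUnipotent F E c 3)) : (quasiSplit F E c 3).Adelic) * k ∈ U)
    (X : AdeleRing (𝓞 E) E) (t : AdeleRing (𝓞 F) F) :
    f (((quasiSplit F E c 3).toAdelic (weylLongU (c : E →+* E) (rfl : ((StdForm.antidiagonal 3).over E) = ((StdForm.antidiagonal 3).over E)))) *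
        ((heisChart hc (X, traceZeroLine F E c hcδ hδ (t + l')) : ↥(adelicUnipotent F E c 3)) : (quasiSplit F E c 3).Adelic) * k) =
      f (((quasiSplit F E c 3).toAdelic (weylLongU (c : E →+* E) (rfl : ((StdForm.antidiagonal 3).over E) = ((StdForm.antidiagonal 3).over E)))) *
        ((heisChart hc (X, traceZeroLine F E c hcδ hδ t) : ↥(adelicUnipotent F E c 3)) : (quasiSplit F E c 3).Adelic) * k) := by
  rw [map_add, ← heisChart_mul_zero hc X, Subgroup.coe_mul]
  have e : ((quasiSplit F E c 3).toAdelic (weylLongU (c : E →+* E) (rfl : ((StdForm.antidiagonal 3).over E) = ((StdForm.antidiagonal 3).over E)))) *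
      (((heisChart hc (X, traceZeroLine F E c hcδ hδ t) : ↥(adelicUnipotent F E c 3)) : (quasiSplit F E c 3).Adelic) *
        ((heisChart hc ((0 : AdeleRing (𝓞 E) E), traceZeroLine F E c hcδ hδ l') : ↥(adelicUnipotent F E c 3)) : (quasiSplit F E c 3).Adelic)) * k =
      ((quasiSplit F E c 3).toAdelic (weylLongU (c : E →+* E) (rfl : ((StdForm.antidiagonal 3).over E) = ((StdForm.antidiagonal 3).over E)))) *
        ((heisChart hc (X, traceZeroLine F E c hcδ hδ t) : ↥(adelicUnipotent F E c 3)) : (quasiSplit F E c 3).Adelic) * k *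
        (k⁻¹ * ((heisChart hc ((0 : AdeleRing (𝓞 E) E), traceZeroLine F E c hcδ hδ l') : ↥(adelicUnipotent F E c 3)) : (quasiSplit F E c 3).Adelic) * k) := by
    group
  rw [e, hfU _ hk]

/-! ## §3 Majorants: the master majorant at the rational big-cell cosets, `hloc`, `hΦc`, `hΦi` -/

omit [Algebra.IsQuadraticExtension F E] in
/-- A locally uniform summable majorant is uniform on compact sets, with NON-NEGATIVE output (finite subcover; `N`-generic copy of K2E1-p09's `N = 2` lemma). [folklore] -/
theorem exists_summable_majorant_on_isCompact' {N : ℕ} {Q : Type*} {f : (quasiSplit F E c N).Adelic → ℂ}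
    {T : Q → (quasiSplit F E c N).Adelic → (quasiSplit F E c N).Adelic}
    (hmaj : ∀ y₀ : (quasiSplit F E c N).Adelic, ∃ V ∈ 𝓝 y₀, ∃ u : Q → ℝ, Summable u ∧ ∀ y ∈ V, ∀ q, ‖f (T q y)‖ ≤ u q)
    {S : Set (quasiSplit F E c N).Adelic} (hS : IsCompact S) :
    ∃ u : Q → ℝ, (∀ q, 0 ≤ u q) ∧ Summable u ∧ ∀ y ∈ S, ∀ q, ‖f (T q y)‖ ≤ u q := by
  classical
  choose V hV u hu hle using hmaj
  obtain ⟨t, -, hcover⟩ := hS.elim_nhds_subcover V fun y _ => hV y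
  have hnn : ∀ y₀ q, 0 ≤ u y₀ q := fun y₀ q => (norm_nonneg _).trans (hle y₀ y₀ (mem_of_mem_nhds (hV y₀)) q)
  refine ⟨fun q => ∑ y₀ ∈ t, u y₀ q, fun q => Finset.sum_nonneg fun y₀ _ => hnn y₀ q, summable_sum fun y₀ _ => hu y₀, fun y hy q => ?_⟩
  obtain ⟨y₁, hy₁, hyV⟩ := Set.mem_iUnion₂.1 (hcover hy)
  exact (hle y₁ y hyV q).trans (Finset.single_le_sum (f := fun y₀ => u y₀ q) (fun y₀ _ => hnn y₀ q) hy₁)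

/-- **THE MASTER MAJORANT AT THE RATIONAL BIG-CELL COSETS.**  If the left Eisenstein terms `q ↦ f(ι(q̃)·y)` of a left-`B(F)`-invariant `f` admit a locally uniform summable
majorant on `B(F)∖U(J₃)(F)`, then for compact `C_X ⊆ 𝔸_E`, `C ⊆ 𝔸_F` and every `g` there is ONE summable `U : E × F → ℝ`, `U ≥ 0`, with
`‖f(ι(w₀) · u((x₀)_𝔸, θ τ_𝔸) · (u(X, θ t) · g))‖ ≤ U(x₀, τ)` for all `X ∈ C_X`, `t ∈ C`, `(x₀, τ) ∈ E × F`: the left factor is `ι(w₀ · u(x₀, τδ))` (§1), the Eisenstein term at the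
coset `[w₀ u(x₀, τδ)]` (★ `eisensteinSeriesU_term_eq`), these cosets are pairwise distinct (§1), and `u(C_X, θ C) · g` is compact. [cite: Garrett2018, §2.8–§2.9]
[cite: MoeglinWaldspurger1995, II.1.7] -/
theorem exists_summable_majorant_weylLongU_ratHeis_three (hc : c * c = 1) (hcδ : c δ = -δ) (hδ : δ ≠ 0) {f : (quasiSplit F E c 3).Adelic → ℂ}
    (hfB : ∀ b ∈ borelU (c : E →+* E) ((StdForm.antidiagonal 3).over E), ∀ x : (quasiSplit F E c 3).Adelic, f ((quasiSplit F E c 3).toAdelic b * x) = f x)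
    (hmaj : ∀ y₀ : (quasiSplit F E c 3).Adelic, ∃ V ∈ 𝓝 y₀,
      ∃ u : Quotient (orbitRel ↥(borelU (c : E →+* E) ((StdForm.antidiagonal 3).over E)) ↥(unitaryGroupOfForm (c : E →+* E) ((StdForm.antidiagonal 3).over E))) → ℝ,
        Summable u ∧ ∀ y ∈ V, ∀ q, ‖f ((quasiSplit F E c 3).toAdelic (q.out : ↥(unitaryGroupOfForm (c : E →+* E) ((StdForm.antidiagonal 3).over E))) * y)‖ ≤ u q)
    {CX : Set (AdeleRing (𝓞 E) E)} (hCX : IsCompact CX) {C : Set (AdeleRing (𝓞 F) F)} (hC : IsCompact C) (g : (quasiSplit F E c 3).Adelic) :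
    ∃ U : E × F → ℝ, (∀ p, 0 ≤ U p) ∧ Summable U ∧ ∀ X ∈ CX, ∀ t ∈ C, ∀ p : E × F,
      ‖f (((quasiSplit F E c 3).toAdelic (weylLongU (c : E →+* E) (rfl : ((StdForm.antidiagonal 3).over E) = ((StdForm.antidiagonal 3).over E)))) *
          ((heisChart hc (algebraMap E (AdeleRing (𝓞 E) E) p.1, traceZeroLine F E c hcδ hδ (algebraMap F (AdeleRing (𝓞 F) F) p.2)) : ↥(adelicUnipotent F E c 3)) :
            (quasiSplit F E c 3).Adelic) *
          (((heisChart hc (X, traceZeroLine F E c hcδ hδ t) : ↥(adelicUnipotent F E c 3)) : (quasiSplit F E c 3).Adelic) * g))‖ ≤ U p := by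
  classical
  -- the compact set `u(C_X, θ C) · g` and a uniform majorant on it
  set Y : AdeleRing (𝓞 E) E × AdeleRing (𝓞 F) F → (quasiSplit F E c 3).Adelic := fun r =>
    ((heisChart hc (r.1, traceZeroLine F E c hcδ hδ r.2) : ↥(adelicUnipotent F E c 3)) : (quasiSplit F E c 3).Adelic) * g with hY
  have hYc : Continuous Y :=
    (continuous_subtype_val.comp ((heisChart hc).continuous.comp (continuous_fst.prodMk ((traceZeroLine F E c hcδ hδ).continuous.comp continuous_snd)))).mul
      continuous_const
  obtain ⟨uQ, huQ0, huQ, hleQ⟩ := exists_summable_majorant_on_isCompact'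
    (T := fun (q : Quotient (orbitRel ↥(borelU (c : E →+* E) ((StdForm.antidiagonal 3).over E)) ↥(unitaryGroupOfForm (c : E →+* E) ((StdForm.antidiagonal 3).over E))))
      (y : (quasiSplit F E c 3).Adelic) => (quasiSplit F E c 3).toAdelic (q.out : ↥(unitaryGroupOfForm (c : E →+* E) ((StdForm.antidiagonal 3).over E))) * y)
    hmaj ((hCX.prod hC).image hYc)
  -- the rational big-cell elements `n(x₀, τ) ∈ N(F)` and their (pairwise distinct) cosets `[w₀ n(x₀, τ)]`
  choose nU hnU hmat using fun p : E × F => exists_unipotentU_toAdelic_eq_heisChart hc hcδ hδ p.1 p.2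
  set ι : E × F → Quotient (orbitRel ↥(borelU (c : E →+* E) ((StdForm.antidiagonal 3).over E)) ↥(unitaryGroupOfForm (c : E →+* E) ((StdForm.antidiagonal 3).over E))) :=
    fun p => Quotient.mk _ (weylLongU (c : E →+* E) (rfl : ((StdForm.antidiagonal 3).over E) = ((StdForm.antidiagonal 3).over E)) *
      (nU p : ↥(unitaryGroupOfForm (c : E →+* E) ((StdForm.antidiagonal 3).over E)))) with hι
  refine ⟨fun p => uQ (ι p), fun p => huQ0 _, huQ.comp_injective (injective_borelQuotient_weylLongU_mul hδ hmat), fun X hX t ht p => ?_⟩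
  have hmul : (quasiSplit F E c 3).toAdelic (weylLongU (c : E →+* E) (rfl : ((StdForm.antidiagonal 3).over E) = ((StdForm.antidiagonal 3).over E)) *
        (nU p : ↥(unitaryGroupOfForm (c : E →+* E) ((StdForm.antidiagonal 3).over E)))) =
      (quasiSplit F E c 3).toAdelic (weylLongU (c : E →+* E) (rfl : ((StdForm.antidiagonal 3).over E) = ((StdForm.antidiagonal 3).over E))) *
        ((heisChart hc (algebraMap E (AdeleRing (𝓞 E) E) p.1, traceZeroLine F E c hcδ hδ (algebraMap F (AdeleRing (𝓞 F) F) p.2)) : ↥(adelicUnipotent F E c 3)) :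
          (quasiSplit F E c 3).Adelic) := by
    rw [← hnU p]
    exact map_mul _ _ _
  rw [← hmul, ← eisensteinSeriesU_term_eq hfB]
  exact hleQ (Y (X, t)) (Set.mem_image_of_mem Y (Set.mk_mem_prod hX ht)) (ι p)

/-- **`hloc`: POISSON'S LOCALLY UNIFORM MAJORANT OF THE `F`-TRANSLATES ALONG THE CENTRE LINE**, for EVERY `X ∈ 𝔸_E`: for compact `C ⊆ 𝔸_F` and every `g` ONE summable `u : F → ℝ` with
`‖Φ_g(X, x + ξ)‖ ≤ u(ξ)` for `x ∈ C`, `ξ ∈ F` — `u(X, θ(x + ξ)) = u(0, θ ξ) · u(X, θ x)` (§1) and §3's master majorant at the cosets `[w₀ u(0, ξδ)]`. The `hloc` binder of ★ p857586 is the case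
`X = (x₀)_𝔸`. [cite: Garrett2018, §2.8–§2.9] [cite: MoeglinWaldspurger1995, II.1.7] [cite: CasselsFrohlichANT1967, Ch. XV Lemma 4.2.4] -/
theorem exists_summable_majorant_centre_translate_three (hc : c * c = 1) (hcδ : c δ = -δ) (hδ : δ ≠ 0) {f : (quasiSplit F E c 3).Adelic → ℂ}
    (hfB : ∀ b ∈ borelU (c : E →+* E) ((StdForm.antidiagonal 3).over E), ∀ x : (quasiSplit F E c 3).Adelic, f ((quasiSplit F E c 3).toAdelic b * x) = f x)
    (hmaj : ∀ y₀ : (quasiSplit F E c 3).Adelic, ∃ V ∈ 𝓝 y₀,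
      ∃ u : Quotient (orbitRel ↥(borelU (c : E →+* E) ((StdForm.antidiagonal 3).over E)) ↥(unitaryGroupOfForm (c : E →+* E) ((StdForm.antidiagonal 3).over E))) → ℝ,
        Summable u ∧ ∀ y ∈ V, ∀ q, ‖f ((quasiSplit F E c 3).toAdelic (q.out : ↥(unitaryGroupOfForm (c : E →+* E) ((StdForm.antidiagonal 3).over E))) * y)‖ ≤ u q)
    {CX : Set (AdeleRing (𝓞 E) E)} (hCX : IsCompact CX) {C : Set (AdeleRing (𝓞 F) F)} (hC : IsCompact C) (g : (quasiSplit F E c 3).Adelic) :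
    ∃ u : F → ℝ, (∀ ξ, 0 ≤ u ξ) ∧ Summable u ∧ ∀ X ∈ CX, ∀ x ∈ C, ∀ ξ : F,
      ‖f (((quasiSplit F E c 3).toAdelic (weylLongU (c : E →+* E) (rfl : ((StdForm.antidiagonal 3).over E) = ((StdForm.antidiagonal 3).over E)))) *
          ((heisChart hc (X, traceZeroLine F E c hcδ hδ (algebraMap F (AdeleRing (𝓞 F) F) ξ + x)) : ↥(adelicUnipotent F E c 3)) : (quasiSplit F E c 3).Adelic) * g)‖ ≤ u ξ := by
  obtain ⟨U, hU0, hU, hle⟩ := exists_summable_majorant_weylLongU_ratHeis_three hc hcδ hδ hfB hmaj hCX hC g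
  have hinj : Function.Injective fun ξ : F => ((0 : E), ξ) := fun ξ ξ' h => (Prod.mk.inj h).2
  refine ⟨fun ξ => U (0, ξ), fun ξ => hU0 _, hU.comp_injective hinj, fun X hX x hx ξ => ?_⟩
  have e : ((heisChart hc (X, traceZeroLine F E c hcδ hδ (algebraMap F (AdeleRing (𝓞 F) F) ξ + x)) : ↥(adelicUnipotent F E c 3)) : (quasiSplit F E c 3).Adelic) =
      ((heisChart hc (algebraMap E (AdeleRing (𝓞 E) E) (0 : E), traceZeroLine F E c hcδ hδ (algebraMap F (AdeleRing (𝓞 F) F) ξ)) : ↥(adelicUnipotent F E c 3)) :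
          (quasiSplit F E c 3).Adelic) *
        ((heisChart hc (X, traceZeroLine F E c hcδ hδ x) : ↥(adelicUnipotent F E c 3)) : (quasiSplit F E c 3).Adelic) := by
    rw [map_zero, ← Subgroup.coe_mul, heisChart_zero_mul hc, map_add, add_comm]
  have h := hle X hX x hx ((0 : E), ξ)
  dsimp only at h
  rw [e]
  simp only [mul_assoc] at h ⊢
  exact h

/-- **`hΦc`: `(X, t) ↦ f(ι(w₀)·u(X, θ t)·g)` is jointly continuous**, hence so is every fibre `t ↦ Φ_g(X, t)` (the chart and `θ` are continuous ★). [cite: Rogawski1990, §1.10] -/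
theorem continuous_weylLongU_mul_heisChart_mul (hc : c * c = 1) (hcδ : c δ = -δ) (hδ : δ ≠ 0) {α : Type*} [TopologicalSpace α]
    {f : (quasiSplit F E c 3).Adelic → α} (hf : Continuous f) (g : (quasiSplit F E c 3).Adelic) :
    Continuous fun r : AdeleRing (𝓞 E) E × AdeleRing (𝓞 F) F =>
      f (((quasiSplit F E c 3).toAdelic (weylLongU (c : E →+* E) (rfl : ((StdForm.antidiagonal 3).over E) = ((StdForm.antidiagonal 3).over E)))) *
        ((heisChart hc (r.1, traceZeroLine F E c hcδ hδ r.2) : ↥(adelicUnipotent F E c 3)) : (quasiSplit F E c 3).Adelic) * g) :=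
  hf.comp ((continuous_const.mul (continuous_subtype_val.comp ((heisChart hc).continuous.comp
    (continuous_fst.prodMk ((traceZeroLine F E c hcδ hδ).continuous.comp continuous_snd))))).mul continuous_const)

/-- **`hΦi`: THE CENTRE-LINE FIBRE `t ↦ Φ_g(X, t)` IS INTEGRABLE ON `𝔸_F` FOR EVERY `X ∈ 𝔸_E`** (additive Haar `μ`; `f` continuous, left-`B(F)`-invariant, with the Eisenstein
majorant `hmaj`) — §0 with the majorant of `exists_summable_majorant_centre_translate_three` on `C = D_F⁻` (relatively compact ★). The `hΦi` binder of ★ p857586 is the case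
`X = (x₀)_𝔸`; no `hfin`, no local integral. [cite: MoeglinWaldspurger1995, II.1.7] [cite: Garrett2018, §2.8–§2.9] -/
theorem integrable_centreLine_three (hc : c * c = 1) (hcδ : c δ = -δ) (hδ : δ ≠ 0)
    [MeasurableSpace (AdeleRing (𝓞 F) F)] [BorelSpace (AdeleRing (𝓞 F) F)] (μ : Measure (AdeleRing (𝓞 F) F)) [μ.IsAddHaarMeasure]
    {f : (quasiSplit F E c 3).Adelic → ℂ} (hf : Continuous f)
    (hfB : ∀ b ∈ borelU (c : E →+* E) ((StdForm.antidiagonal 3).over E), ∀ x : (quasiSplit F E c 3).Adelic, f ((quasiSplit F E c 3).toAdelic b * x) = f x)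
    (hmaj : ∀ y₀ : (quasiSplit F E c 3).Adelic, ∃ V ∈ 𝓝 y₀,
      ∃ u : Quotient (orbitRel ↥(borelU (c : E →+* E) ((StdForm.antidiagonal 3).over E)) ↥(unitaryGroupOfForm (c : E →+* E) ((StdForm.antidiagonal 3).over E))) → ℝ,
        Summable u ∧ ∀ y ∈ V, ∀ q, ‖f ((quasiSplit F E c 3).toAdelic (q.out : ↥(unitaryGroupOfForm (c : E →+* E) ((StdForm.antidiagonal 3).over E))) * y)‖ ≤ u q)
    (X : AdeleRing (𝓞 E) E) (g : (quasiSplit F E c 3).Adelic) :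
    Integrable (fun t : AdeleRing (𝓞 F) F =>
      f (((quasiSplit F E c 3).toAdelic (weylLongU (c : E →+* E) (rfl : ((StdForm.antidiagonal 3).over E) = ((StdForm.antidiagonal 3).over E)))) *
        ((heisChart hc (X, traceZeroLine F E c hcδ hδ t) : ↥(adelicUnipotent F E c 3)) : (quasiSplit F E c 3).Adelic) * g)) μ := by
  obtain ⟨u, hu0, hu, hle⟩ := exists_summable_majorant_centre_translate_three hc hcδ hδ hfB hmaj isCompact_singleton (isCompact_closure_adeleFundamentalDomain F) g
  refine integrable_of_lattice_majorant F μ ?_ hu0 hu fun x hx ξ => hle X (mem_singleton X) x (subset_closure hx) ξ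
  exact ((continuous_weylLongU_mul_heisChart_mul hc hcδ hδ hf g).comp (continuous_const.prodMk continuous_id)).aestronglyMeasurable

end Heisenberg

end Summit.HodgeConjecture.HodgeConjecture.Cruxes.H413.K2E1FlatSectionLineRestrictionU3

end
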